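import Summits.QuantumFields.QCD.Theses.HeatSlicedQuarks
import Summits.QuantumFields.QCD.Theorems.GluonicCompletion.Negative.Threshold
import Literature.MathematicalPhysics.QuantumLattice.WilsonPropagatorHeavyMass
import Literature.Barriers.QuantumFields.WilsonDeterminantMassSplitting

/-!
# Disproof of `RobustYangMillsHandover` — findings (cdisprove seat, cycles 1–3, 2026-08-16)

Crux `stmt-QuantumFields-8892`, route `HeatSlicedQuarks`, typed body

  `RobustYangMillsHandover := ContinuumQCDExists → _root_.QCD`.

VERDICT SO FAR: **no kill; refutation-immune by form.** Everything below is kernel-checked.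

* §1 Structure ("why it resists"): `¬ RobustYangMillsHandover ↔ ContinuumQCDExists ∧ ¬ QCD`
  (`not_handover_iff`), `QCD → RobustYangMillsHandover` (`handover_of_qcd`),
  `QCD → ContinuumQCDExists` (`continuumQCDExists_of_qcd`), and
  `RobustYangMillsHandover ↔ (ContinuumQCDExists ↔ QCD)` (`handover_iff_target_iff_qcd`).
  A disproof must therefore CONSTRUCT continuum `SU(3)` QCD with dynamical quarks for `N_f = 2, 3`
  (the route target X₀, open) AND refute the summit conjunct's gap clauses. Neither half is cheap.
* §2 Load-bearing analysis of the ANTECEDENT (the crux has one hypothesis, X₀; inside X₀ the only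
  clauses a junk model can shed are the three non-triviality clauses):
  `ContinuumQCDExistsWithoutNontriviality` (X₀ minus `IsNontrivial glue`, `IsNonGaussian glue`,
  `IsNontrivial (pseudoRe f g)`) HOLDS outright (`continuumQCDExistsWithoutNontriviality_holds`:
  regularisation `canonicalAF`, species renormalisations `z = shift = 0`, OS data = the vacuum), so
  the handover weakened to accept such data is LITERALLY the summit conjunct
  (`handoverWithoutNontriviality_iff_qcd`). Reading for provers: a proof of the crux must USE the
  non-triviality of the handed-over `T`; the rest of X₀'s data (asymptotic scaling, `m_f(k) > −1`,
  `HasMassScaling`, convergence of all lattice `n`-point functions) is satisfiable by junk.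
* §3 Junk-model census for X₀ itself (why the antecedent is NOT junk-inhabitable, hence why §1 bites):
  recorded as docstrings on `vacuum_not_witness` — vacuum (fails `IsNontrivial`), constant field
  `z·shift → c` (truncated two-point function vanishes), random constant / phase mixture (fails E4
  `cluster`, a FIELD of `OSData`), white noise / any ultralocal limit at fixed `β` (fails `IsNontrivial`,
  which tests on time-separated supports; also barred by `HasAsymptoticScaling`), infinitely heavy
  quarks `m_crit(k) → ∞` (fails the flavour-changing `pseudoRe` clause: decay rate `(2/a_k) log 2m(k) → ∞`
  cannot be renormalised away by a separation-independent `z(k)`). Schwinger functionals are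
  `→L[ℂ]` and `IsQCDAlong` pins them on real off-diagonal tensors, whose span is dense in `⁰𝒮`, so no
  freedom is left off the real tensors either.
* §4 Natural strengthenings: the author's informal "same scheme" (pointwise) handover
  `HandoverPointwise` is stated; it implies the crux (`handover_of_pointwise`); it is NOT junk-refutable
  for the same reason (its antecedent carries the non-triviality clauses) — see its docstring for the
  physics-level strengthenings that WOULD be refutable only with open lattice results (gaplessness at
  `κ_c`, Aoki phase).
* §5 Threshold reduction (the "unpinned M₀" loophole, formal): the crux already follows from the
  pointwise handover restricted to mass tuples above an ARBITRARY threshold `M₀`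
  (`handover_of_aboveThreshold`, via the landed `GluonicCompletion.Negative.qcdOf_iff_threshold`): only
  the heavy-quark regime is ever needed, exactly the scope of the informal mechanism; the chiral regime
  is irrelevant to this crux as typed. The restricted form is refutation-immune for the same reason as §4.
  CAVEAT (crux-plan FINDINGs `FINDING-thresholds-ratios.md`, `FindingThresholdHierarchy.md`, 2026-08-16,
  kernel-checked `matchedScale_ratio_tendsto_atTop` in `Lines/geometric-mean-handover.lean`): the threshold
  absorbs only a COMMON offset, never mass RATIOS — hierarchical tuples `(M, M, s)`, `s → ∞`, above any
  threshold make the light flavours chiral relative to the induced `(N_f−1)`-flavour scale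
  `Λ' = Λ^{1−2N_f/33} ∏ m_f^{2/33}`; so "only heavy quarks" holds relative to `Λ` and the offset, NOT relative
  to the dynamical scale of the tuple, and every pure-Yang–Mills handover covers only ratio-tempered cones.
* §6 (cycle 2) SAME-REGULARISATION ANALYSIS: `HasLatticeMassGap` never reads `z, shift, T`
  (`hasLatticeMassGap_scheme_indep`, `Iff.rfl`), so for a prover who keeps X₀'s `reg` the two gap
  clauses SEPARATE (`sameReg_iff : HandoverSameReg ↔ SameRegContinuumGap ∧ SameRegLatticeGap`, common
  `Δ` = min, via `hasMassGap_anti` / `hasLatticeMassGap_anti`): the lattice half is a statement about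
  lattice QCD along X₀'s bare trajectory ALONE (`latticeGapped_of_sameReg`), to which the handover
  contributes no continuum datum. Chain: `HandoverPointwise → HandoverSameReg → crux`.
* §7 (cycle 2) `handover_of_perFlavour`; `not_handover_iff'`:
  `¬ crux ↔ X₀(2) ∧ X₀(3) ∧ (¬ QCDOf 2 ∨ ¬ QCDOf 3)`.
* §8 (cycle 2) THRESHOLD FORM OF THE ANTECEDENT: `continuumQCDExistsOf_iff_threshold`
  (`X₀(N_f) ↔ ∃ M₀ ≥ 0, X₀ above M₀`, shift of `m_crit`), `handover_iff_thresholdForm` — hypothesis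
  and conclusion BOTH speak only above unpinned, mutually independent offsets.
* §9 (cycle 2) AUDIT OF THE INFORMAL MECHANISM, two checkable corrections: (i) "norm `η(j*) → 0` as
  `k → ∞`" is wrong at a fixed physical handover scale — the marginal part of the heavy-quark `δS` is
  the quark-loop coupling shift `2(b₀(0) − b₀(N_f)) log(1/(a²M²)) → +∞` (`quarkLoopShift_tendsto_atTop`,
  `betaCoeff₀_zero_sub`), absorbed only by re-tuning `β` (β-universality), and the irrelevant remainder
  is `O((μ*/M)²)`, FIXED in `k`: robust YM must be openness under perturbations of a fixed small size,
  not an asymptotically vanishing one; (ii) "coercivity of the TUNED flow": by `HasMassScaling`,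
  `Z_m → ∞` (`tendsto_Zm_atTop`), so the bare trajectory `m_crit(k) + a_k m_f/Z_m(k)` is eventually
  `< −δ/2` whenever `m_crit(k) ≤ −δ` eventually (`scheme_mq_eventually_neg`) — the fine-lattice
  Wilson–Dirac operator at the scheme's bare mass is NOT accretive; coercivity can only be a property
  of a blocked operator below the quark scale (informal `HeavyBlockIntegration` of the sibling route).
* §10 (cycle 2) TIGHTNESS for §9(ii): at `U ≡ 1` site-constant colour–spin vectors are eigenvectors of
  the tree's `wilsonDirac` with eigenvalue the bare mass `m` (`wilsonDirac_one_mulVec_const`), so the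
  accretivity bound of support item `AccretiveWilsonDirac` is attained (`accretivity_tight`) and is
  NEGATIVE at the negative bare masses of the handed-over trajectory (`numericalRange_neg_of_mass_neg`).
* §12 (cycle 3) HOPPING WINDOW + BARRIER TRANSFER (landed as `Negative/HoppingWindow.lean`, p76404):
  (A) along the handed-over trajectory the Wilson hopping parameter `κ_f(k) = 1/(2m_f(k)+8)` lies
  eventually in `1/8 < κ < 1/6` (`scheme_hoppingParam_window'`; one-loop-deep `m_crit` + physical
  branch): INSIDE Lüscher's transfer-matrix positivity range, OUTSIDE Seiler's `det > 0` /
  background-uniform hopping-convergence disc `κ < 1/8` (catalogued `HoppingExpansionLocality`, tree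
  `WilsonPropagatorHeavyMass`). (B) TIGHTNESS: the tree's heavy-mass Neumann bound
  `‖1 − (m+4)⁻¹D_W(U,m,1)‖ ≤ 4/(m+4)` is ATTAINED at `U ≡ 1` on constant modes
  (`norm_hopOperator_one_eq`), `≥ 1` iff `m ≤ 0`, and the hopping series (MM (5.36)) applied to a
  constant mode does not even have terms `→ 0` for `m ≤ 0` (`hoppingSeries_term_not_tendsto_zero'`):
  the informal mechanism's "convergent heavy-hopping / polymer expansion" is illegitimate for the FINE
  operator at the scheme's bare mass on the smoothest background — it can only be a statement about a
  blocked operator (consistent with §9(ii), now at the level of the expansion itself, not just of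
  accretivity). (C) SIGN: bare masses are ordered like renormalised ones with splitting
  `a_k Δm/Z_m(k) → 0` (`scheme_mq_sub'`, `tendsto_scheme_mq_sub'`); the catalogued ChiralRegime barriers
  `WilsonDeterminantSign` (`sign det D_W = (−1)^{n₋}`) and `WilsonDeterminantMassSplitting` therefore
  apply VERBATIM to the massive conjunct's lattice gap clause: for every non-degenerate tuple (N_f = 2)
  and every tuple (N_f = 3) `HasLatticeMassGap` is a clustering statement about the SIGNED functional
  `qcdTorusExpect`, over ALL volumes `S ≥ L_k` at fixed cutoff, and a negative split weight at step `k`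
  pins an exact zero mode of `D_W(U,·,1)` inside the shrinking interval `(m_f(k), m_g(k))`
  (`splitWeight_neg_imp_zeroMode_between'`). Empirical side (cited, not formal): the critical mass lies
  INSIDE Edwards–Heller–Narayanan's gapless region II of `γ₅D_W` ("We find m_c > m₁, indicating that m_c
  lies inside region II", hep-lat/9802016 §2, page-verified), so odd-`n₋` configurations occur at the
  scheme's parameters; Mohler–Schaefer 2020 frequencies 2% → 0.05% (β = 3.4 → 3.7). CERTIFIED INSTANCE
  (this seat, exact integer arithmetic over ℤ[i], crux dir `OddIndexWitnessL2.md` + item evidence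
  `OddIndexWitnessL2.json`): on the 2⁴ torus an EXACT SU(3) field (Gaussian-rational links) with
  `det D_W(U, −27/32, 1) < 0 < det D_W(U, −4/5, 1)` — physical branch, `κ ≈ 0.158 ∈ (1/8, 1/6)`: the
  single-flavour weight IS negative inside the hopping window already on the smallest non-degenerate torus,
  the N_f = 2 split weight at bare masses `(−27/32, −4/5)` is negative, and a real mode sits in
  `(−0.84375, −0.8)`; the 1⁴ torus has no real modes in 38/38 exact samples. (Arb re-certification for
  L = 2, 3 queued as compute job j011174; it attaches to the item by itself.) READING FOR LINES:
  positivity-based gap levers (LSI/Poincaré, DS mixing, correlation inequalities, "rare bad blocks"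
  probability bookkeeping) need the Rao–Blackwell step of card `rao-blackwell-sign` or an explicit
  signed-measure control; the docstring route "coercivity ⇒ det_eff > 0" is available only for a
  BLOCKED operator, never configuration-wise at the cutoff (B).
* §13 (cycle 3) QUANTIFIER AUDIT OF THE SHARED STUB `GapTransfer` (8923; used by all four `Lines/*.lean`):
  `HasLatticeMassGap` is `∀(A,B) ∃C ∃k₀` (per pair), while the transfer to `T.HasMassGap` at a fixed large
  `k` must bound k-DEPENDENT composites (smeared fields with supports `~1/a_k`, products at separations
  `~t/a_k`); the direct "bounds pass to the limit" route fails formally (constants `z(k)² C → ∞`; spatial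
  offsets are distinct observables with distinct thresholds); the spectral route closes the TWO-POINT case
  from finitely many species representatives (spectral subspaces are translation invariant) but the
  `(n+k) ≥ 3` clustering of `MassGapOS` needs the full-space gap at step `k`, i.e. the `∃k₀ ∀(A,B)` form that
  the clause does not state; plus Lüscher positivity on ODD tori `2S+1` with time-periodic Wilson fermions
  (`(−1)^F`-twisted trace, joint space-time thermodynamic limit before `k → ∞`). No kill (honest lattice QCD
  presumably satisfies both forms); a recommendation for planners is recorded in §13.
* SIBLING TYPED PIECES of "robust YM" now exist (route `HeavyThresholdYMBridge`, after the definition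
  `QuasiLocalGaugePerturbation` landed): `RobustYangMills` (stmt-13897, rev 4 — twice repaired after
  refuter crux-attacks: the D1 weighted norm admitted range-`S` two-plaquette couplings with connected
  correlations `≍ 1/S`; repaired with range control (h4) and coupling-relative `η`),
  `YMLatticeGapAlongAFSequences` (stmt-8796, β-universality of the lattice gap), `HeavyLatticeGapFromYM`
  (stmt-8795). A refutation of any of them would NOT falsify this crux (bare arrow), cf. §1.
* `-- Targets`: none yet (no line picked, `stuck_stubs = []` at both arm times).

LANDED (negative lane): cycle 3 — p76404 `Negative/HoppingWindow.lean` (§12, pending verdict at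
write time); cycle 2 — p73906 `Negative/GapClauses.lean` (§§6–8, definition-free:
`hasLatticeMassGap_scheme_indep`, `hasMassGap_anti`, `hasLatticeMassGap_anti`, `gapClauses_split`,
`qcdOf_iff_split`, `not_handover_iff(_perFlavour)`, `continuumQCDExists_iff_threshold`), p74190/p74635
`Negative/SchemeAsymptotics.lean` (§9: `quarkLoopShift_tendsto_atTop`, `tendsto_Zm_atTop`,
`scheme_mq_eventually_neg(_of_logBound)`, `tendsto_a_mul_log_inv_sq`), p75175 `Negative/FreeWilsonModes.lean`
(§10); cycle 1 — p72824 (commit 847699f2bdc9):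
`Summits/QuantumFields/QCD/Theorems/RobustYangMillsHandover/Negative/WithoutNontriviality.lean` —
`continuumQCDExists_withoutNontriviality_holds`, `handover_withoutNontriviality_iff_qcd`,
`isQCDAlong_scheme_zero_vacuum`, `hasAsymptoticScaling_canonicalAF_scheme` (importable by ideators /
planners; §2 below duplicates them so that this workfile stays self-contained).
§11 LITERATURE (cycle 2; searchd down in both cycles, Crossref + held texts only; page-verified where quoted):
* Shape of a genuine robust-gap THEOREM (Hamiltonian lattice systems): stability of the spectral gap under
  quasi-local perturbations needs structural hypotheses on the UNPERTURBED model — frustration-freeness /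
  local topological quantum order (Bravyi–Hastings–Michalakis, J. Math. Phys. 51 (2010) 093512,
  doi:10.1063/1.3490195; Bravyi–Hastings, CMP 307 (2011), doi:10.1007/s00220-011-1346-2;
  Nachtergaele–Sims–Young, AHP 23 (2022), doi:10.1007/s00023-021-01086-5, and for lattice FERMIONS
  Contemp. Math. 717 (2018), doi:10.1090/conm/717/14443). None applies to Yang–Mills near the continuum
  limit (not frustration-free; unperturbed gap unknown) — they fix what "robust" has to mean: a gapped
  reference model plus a decay class of perturbations plus a SMALLNESS threshold depending on the model.
* Euclidean robustness where it IS a theorem: strong coupling / high temperature (convergent cluster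
  expansion is analytic in bounded quasi-local perturbations; Osterwalder–Seiler 1978, in tree as the
  barrier `HoppingExpansionUniformGap`) — the regime this crux explicitly avoids.
* A documented GAP-CLOSING POINT in the space of quasi-local SU(3) gauge actions (numerical, accepted):
  the bulk first-order line of the fundamental–adjoint plaquette action ends in a critical endpoint at
  `(β_f*, β_a*) = (4.00(7), 2.06(8))` where "at least one mass in the 0⁺⁺ channel has to vanish", the
  continuum limit there "being a φ⁴ theory with a diverging correlation length only in the 0⁺⁺ channel"
  (Heller, Phys. Lett. B 362 (1995) 123, arXiv:hep-lat/9508009, abstract and §1 — page-verified;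
  Bhanot–Creutz, PRD 24 (1981) 3212, doi:10.1103/physrevd.24.3212; Hasenbusch–Necco, JHEP 08 (2004) 005).
  Consequence for ANY typed "robust YM": openness of the gapped phase cannot be claimed for all couplings
  and all small gauge-invariant quasi-local perturbations with a smallness `η₀` exceeding the distance (in
  the chosen norm, at the relevant block scale) from the Wilson/AF trajectory to that critical surface;
  the sibling `RobustYangMills` (13897) meets this only through its coupling-relative `η` and range
  control. barrier-candidate: `MixedActionCriticalEndpoint` (fundamental–adjoint endpoint, vanishing 0⁺⁺
  mass) for `Literature/Barriers/QuantumFields/`.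
* Decoupling behind §9(i): Appelquist–Carazzone, PRD 11 (1975) 2856, doi:10.1103/physrevd.11.2856 (heavy
  fields decouple up to coupling renormalisation and `O(μ²/M²)` corrections); lattice one-loop data:
  Montvay–Münster (5.62) (`K_cr`), (5.34)–(5.35) (`Δβ` from the hopping expansion) — page-verified.
No printed counterexample to the crux AS TYPED exists or can exist short of a construction of continuum QCD (§1).

Nothing here asserts a Theses decl positively except under hypotheses (pure logic).
-/

namespace Summit.QuantumFields.QCD.Cruxes.RobustYangMillsHandover.Disproof

open Summit.QuantumFields.QCD.Theses.HeatSlicedQuarks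
open Literature.MathematicalPhysics.QuantumFieldTheory
open Literature.MathematicalPhysics.AQFT
open Filter Topology

/-! ## §1 Structure: the crux is refutable iff X₀ is provable and `QCD` is refutable -/

/-- The summit conjunct implies the route target X₀ (drop the gap clause of each `QCDOf`). [folklore] -/
theorem continuumQCDExists_of_qcd : _root_.QCD → ContinuumQCDExists := by
  rintro ⟨h2, h3⟩ Nf hNf
  have key : ∀ Nf, QCDOf Nf → ∃ reg : QCDRegularisation Nf, reg.HasMassScaling ∧
      ∀ m : Fin Nf → ℝ, (∀ f, 0 < m f) → ∃ (z shift : QCDField Nf → ℕ → ℝ) (T : OSData (QCDField Nf) 4),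
        IsQCDAlong (reg.scheme m z shift) T ∧ T.IsNontrivial QCDField.glue ∧
          T.IsNonGaussian QCDField.glue ∧
            ∀ f g : Fin Nf, f ≠ g → T.IsNontrivial (QCDField.pseudoRe f g) := by
    rintro Nf ⟨reg, hms, h⟩
    refine ⟨reg, hms, fun m hm => ?_⟩
    obtain ⟨z, shift, T, hA, hN, hG, hP, -⟩ := h m hm
    exact ⟨z, shift, T, hA, hN, hG, hP⟩
  rcases hNf with rfl | rfl
  · exact key 2 h2
  · exact key 3 h3

/-- `QCD` gives the crux for free (idle hypothesis). [folklore] -/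
theorem handover_of_qcd : _root_.QCD → RobustYangMillsHandover := fun h _ => h

/-- A refutation of the crux is EXACTLY a construction of X₀ together with a refutation of `QCD`.
[folklore] -/
theorem not_handover_iff : ¬ RobustYangMillsHandover ↔ ContinuumQCDExists ∧ ¬ _root_.QCD :=
  Classical.not_imp

/-- Any refutation of the crux refutes the summit conjunct. [folklore] -/
theorem not_qcd_of_not_handover : ¬ RobustYangMillsHandover → ¬ _root_.QCD :=
  fun h q => h (handover_of_qcd q)

/-- The crux says precisely "X₀ and `QCD` are equivalent". [folklore] -/
theorem handover_iff_target_iff_qcd : RobustYangMillsHandover ↔ (ContinuumQCDExists ↔ _root_.QCD) :=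
  ⟨fun h => ⟨h, continuumQCDExists_of_qcd⟩, fun h => h.mp⟩

/-- Given the route target, the crux IS the summit conjunct. [folklore] -/
theorem handover_iff_qcd_of_target (hX : ContinuumQCDExists) : RobustYangMillsHandover ↔ _root_.QCD :=
  ⟨fun h => h hX, fun q _ => q⟩

/-! ## §2 Load-bearing analysis: X₀ without its non-triviality clauses is junk-true -/

/-- X₀ with the three non-triviality clauses (`IsNontrivial glue`, `IsNonGaussian glue`,
`IsNontrivial (pseudoRe f g)`) DROPPED: only the regularisation data, `HasMassScaling`, and
`IsQCDAlong` (asymptotic scaling, physical-branch masses, convergence of all lattice `n`-point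
functions to OS data) remain. -/
def ContinuumQCDExistsWithoutNontriviality : Prop :=
  ∀ Nf : ℕ, Nf = 2 ∨ Nf = 3 → ∃ reg : QCDRegularisation Nf, reg.HasMassScaling ∧
    ∀ m : Fin Nf → ℝ, (∀ f, 0 < m f) →
      ∃ (z shift : QCDField Nf → ℕ → ℝ) (T : OSData (QCDField Nf) 4), IsQCDAlong (reg.scheme m z shift) T

/-- The species renormalisations of `reg.scheme m z shift` are `z`. [folklore] -/
theorem scheme_z {Nf : ℕ} (reg : QCDRegularisation Nf) (m : Fin Nf → ℝ)
    (z shift : QCDField Nf → ℕ → ℝ) : (reg.scheme m z shift).z = z := rfl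

/-- With `z ≡ 0` every lattice `n`-point function (`n ≥ 1`) of ANY scheme vanishes identically
(the smeared insertions are all `0`). [folklore] -/
theorem qcdLatticeSchwinger_eq_zero_of_z {Nf : ℕ} (sch : QCDScheme Nf) (hz : sch.z = 0)
    (k n : ℕ) (hn : n ≠ 0) (σ : Fin n → QCDField Nf)
    (f : Fin n → SchwartzMap (EuclideanSpace ℝ (Fin 4)) ℝ) :
    qcdLatticeSchwinger sch k n σ f = 0 := by
  obtain ⟨j, rfl⟩ := Nat.exists_eq_succ_of_ne_zero hn
  simp [qcdLatticeSchwinger, smearedInsertion, List.ofFn_succ, hz]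

/-- **The junk witness.** For every `N_f`, every regularisation `reg` whose bare couplings scale
asymptotically and every positive mass tuple, the scheme `reg.scheme m 0 0` (species
renormalisations `z = shift = 0`) together with the VACUUM OS data satisfies `IsQCDAlong`.
[folklore] -/
theorem isQCDAlong_scheme_zero_vacuum {Nf : ℕ} (reg : QCDRegularisation Nf)
    (hβ : (reg.scheme 0 0 0).HasAsymptoticScaling) (m : Fin Nf → ℝ) (hm : ∀ f, 0 < m f)
    (hcrit : ∀ᶠ k in atTop, -1 ≤ reg.mcrit k) :
    IsQCDAlong (reg.scheme m 0 0) (OSData.vacuum (QCDField Nf) 4) := by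
  refine ⟨?_, fun fl => ?_, fun n hn σ f F _ _ => ?_⟩
  · -- the coupling data of `reg.scheme m z shift` do not depend on `m, z, shift`
    obtain ⟨Λ, hΛ, h⟩ := hβ
    exact ⟨Λ, hΛ, h⟩
  · filter_upwards [hcrit] with k hk
    have hpos : 0 < reg.a k * m fl / reg.Zm k :=
      div_pos (mul_pos (reg.a_pos k) (hm fl)) (reg.Zm_pos k)
    rw [QCDRegularisation.scheme_mq]
    linarith
  · have hS : (OSData.vacuum (QCDField Nf) 4).schwinger n σ F = 0 := by
      simp [OSData.vacuum, LabelledSchwingerFamily.trivial_of_ne_zero (QCDField Nf) hn]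
    rw [hS]
    refine tendsto_const_nhds.congr' (Eventually.of_forall fun k => ?_)
    exact (qcdLatticeSchwinger_eq_zero_of_z _ (scheme_z reg m 0 0) k n hn σ f).symm

/-- `canonicalAF.scheme m z shift` scales asymptotically (its `β_k` IS the two-loop profile at
`Λ = 1`). [folklore] -/
theorem canonicalAF_scheme_hasAsymptoticScaling (Nf : ℕ) (m : Fin Nf → ℝ)
    (z shift : QCDField Nf → ℕ → ℝ) :
    ((QCDRegularisation.canonicalAF Nf).scheme m z shift).HasAsymptoticScaling :=
  ⟨1, one_pos, by
    simp [QCDRegularisation.scheme, QCDRegularisation.canonicalAF, QCDScheme.zeroAF]⟩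

/-- **X₀ minus non-triviality HOLDS** (junk: `canonicalAF`, `z = shift = 0`, vacuum data).
Hence every clause of X₀ other than the three non-triviality clauses is idle as a hypothesis of the
handover. [folklore] -/
theorem continuumQCDExistsWithoutNontriviality_holds : ContinuumQCDExistsWithoutNontriviality := by
  intro Nf _
  refine ⟨QCDRegularisation.canonicalAF Nf, QCDRegularisation.canonicalAF_hasMassScaling, fun m hm => ?_⟩
  refine ⟨0, 0, OSData.vacuum (QCDField Nf) 4, ?_⟩
  refine isQCDAlong_scheme_zero_vacuum _ (canonicalAF_scheme_hasAsymptoticScaling Nf 0 0 0) m hm ?_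
  exact Eventually.of_forall fun k => by simp [QCDRegularisation.canonicalAF]

/-- **Load-bearing theorem.** The handover with the non-triviality clauses of its antecedent dropped
is EQUIVALENT to the summit conjunct `QCD` itself: those three clauses are the only part of X₀ a proof
of the crux can lean on. (Not a refutation: `QCD` is open.) [folklore] -/
theorem handoverWithoutNontriviality_iff_qcd :
    (ContinuumQCDExistsWithoutNontriviality → _root_.QCD) ↔ _root_.QCD :=
  ⟨fun h => h continuumQCDExistsWithoutNontriviality_holds, fun q _ => q⟩

/-! ## §3 Junk-model census for X₀ (why the antecedent is not junk-inhabitable) -/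

/-- The placeholder inhabitant of `IsQCDAlong` (vacuum data along `canonicalAF.scheme m 0 0`) is NOT
a witness of X₀: it fails `IsNontrivial glue`. Census of the other junk candidates (paper, see the
module docstring §3): constant field (`z(k)·shift(k) → c`, `z → 0`): OS data with `𝔖ₙ = cⁿ ∫`, all
truncated functions vanish ⇒ fails `IsNontrivial`; random constant (mixture): fails the cluster field
E4 of `OSData`; white noise / ultralocal limits (fixed `β`, `z = a⁻²`): two-point function `χ δ(x−y)`
vanishes on the time-separated supports `θF̄ ⊗ G` used by `IsNontrivial` (and fixed `β` violates
`HasAsymptoticScaling`); `m_crit(k) → +∞`: flavour-changing pseudoscalar correlator decays at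
physical rate `(2/a_k) log(2 m(k)) → ∞`, no `z(k)` rescues a nonzero limit at positive separation ⇒
fails `IsNontrivial (pseudoRe f g)`. [folklore] -/
theorem vacuum_not_witness (Nf : ℕ) :
    ¬ (OSData.vacuum (QCDField Nf) 4).IsNontrivial QCDField.glue :=
  OSData.not_isNontrivial_vacuum _

/-- … while the vacuum has EVERY mass gap, so on the consequent side the gap clauses alone would not
separate junk from QCD either — the separating power of the whole statement sits in the
non-triviality clauses, which the crux's antecedent already grants. [folklore] -/
theorem vacuum_hasMassGap' (Nf : ℕ) (Δ : ℝ) : (OSData.vacuum (QCDField Nf) 4).HasMassGap Δ :=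
  OSData.vacuum_hasMassGap Δ

/-! ## §4 Natural strengthenings -/

/-- **The author's informal reading, typed: POINTWISE ("same scheme") handover.** For the very
regularisation, masses, renormalisations and OS data handed over by X₀, a common `Δ > 0` with
`T.HasMassGap Δ` and `(reg.scheme m z shift).HasLatticeMassGap Δ`. Strictly stronger than the crux
(`handover_of_pointwise`). NOT junk-refutable: its antecedent carries the same non-triviality clauses,
so a counterexample is again an honest continuum construction (gapless: e.g. bare masses riding the
chiral critical line `κ_c(β_k)` — massless pions — or inside an Aoki phase; both beyond present
rigorous reach at weak coupling). Recorded so that triagers do not re-derive it. -/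
def HandoverPointwise : Prop :=
  ∀ Nf : ℕ, Nf = 2 ∨ Nf = 3 → ∀ (reg : QCDRegularisation Nf), reg.HasMassScaling →
    ∀ m : Fin Nf → ℝ, (∀ f, 0 < m f) → ∀ (z shift : QCDField Nf → ℕ → ℝ) (T : OSData (QCDField Nf) 4),
      IsQCDAlong (reg.scheme m z shift) T → T.IsNontrivial QCDField.glue → T.IsNonGaussian QCDField.glue →
        (∀ f g : Fin Nf, f ≠ g → T.IsNontrivial (QCDField.pseudoRe f g)) →
          ∃ Δ > 0, T.HasMassGap Δ ∧ (reg.scheme m z shift).HasLatticeMassGap Δ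

/-- The pointwise handover implies the crux. [folklore] -/
theorem handover_of_pointwise : HandoverPointwise → RobustYangMillsHandover := by
  intro h hX
  have key : ∀ Nf, (Nf = 2 ∨ Nf = 3) → QCDOf Nf := by
    intro Nf hNf
    obtain ⟨reg, hms, hb⟩ := hX Nf hNf
    refine ⟨reg, hms, fun m hm => ?_⟩
    obtain ⟨z, shift, T, hA, hN, hG, hP⟩ := hb m hm
    exact ⟨z, shift, T, hA, hN, hG, hP, h Nf hNf reg hms m hm z shift T hA hN hG hP⟩
  exact ⟨key 2 (Or.inl rfl), key 3 (Or.inr rfl)⟩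

/-- **Pointwise handover WITHOUT non-triviality, continuum half, is junk-TRUE on the vacuum witness**
(the vacuum has every gap): dropping non-triviality does not make the continuum gap clause refutable
by the placeholder — a gapless IsQCDAlong model would itself be a non-trivial construction. [folklore] -/
theorem vacuum_witness_has_continuum_gap (Nf : ℕ) :
    ∃ Δ > 0, (OSData.vacuum (QCDField Nf) 4).HasMassGap Δ :=
  ⟨1, one_pos, OSData.vacuum_hasMassGap 1⟩

/-! ## §5 Threshold reduction: only arbitrarily heavy quarks are ever needed -/

/-- **Pointwise handover ABOVE A THRESHOLD.** Some `M₀ ≥ 0` such that for every regularisation with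
`HasMassScaling`, every mass tuple with ALL `m_f > M₀`, and all handed-over data `(z, shift, T)` with
`IsQCDAlong` and the three non-triviality clauses, a common `Δ > 0` gaps `T` and the lattice scheme.
For `M₀` large this is the heavy-quark regime of the informal mechanism (all quarks heavy in units of
`Λ`; handover scale `1/M₀`). -/
def HandoverAboveThreshold : Prop :=
  ∃ M₀ : ℝ, 0 ≤ M₀ ∧ ∀ Nf : ℕ, Nf = 2 ∨ Nf = 3 → ∀ (reg : QCDRegularisation Nf), reg.HasMassScaling →
    ∀ m : Fin Nf → ℝ, (∀ f, M₀ < m f) → ∀ (z shift : QCDField Nf → ℕ → ℝ) (T : OSData (QCDField Nf) 4),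
      IsQCDAlong (reg.scheme m z shift) T → T.IsNontrivial QCDField.glue → T.IsNonGaussian QCDField.glue →
        (∀ f g : Fin Nf, f ≠ g → T.IsNontrivial (QCDField.pseudoRe f g)) →
          ∃ Δ > 0, T.HasMassGap Δ ∧ (reg.scheme m z shift).HasLatticeMassGap Δ

/-- **The crux follows from the handover above ANY threshold** (shift `m_crit(k) ↦ m_crit(k) + a_k M₀/Z_m(k)`,
tree `qcdOf_iff_threshold`): formally, the light-quark / chiral regime never enters
`RobustYangMillsHandover`; a prover may assume every renormalised mass exceeds any fixed `M₀`.
CAVEAT (crux-plan FINDINGs, 2026-08-16): `M₀` is a common OFFSET; mass RATIOS above it are unbounded, and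
hierarchical tuples are light-flavour physics relative to the induced scale (see the module docstring §5).
[folklore] -/
theorem handover_of_aboveThreshold : HandoverAboveThreshold → RobustYangMillsHandover := by
  rintro ⟨M₀, hM₀, h⟩ hX
  have key : ∀ Nf, (Nf = 2 ∨ Nf = 3) → QCDOf Nf := by
    intro Nf hNf
    obtain ⟨reg, hms, hb⟩ := hX Nf hNf
    refine (Theorems.GluonicCompletion.Negative.qcdOf_iff_threshold Nf).mpr ⟨M₀, hM₀, reg, hms, fun m hm => ?_⟩
    have hm0 : ∀ f, 0 < m f := fun f => lt_of_le_of_lt hM₀ (hm f)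
    obtain ⟨z, shift, T, hA, hN, hG, hP⟩ := hb m hm0
    exact ⟨z, shift, T, hA, hN, hG, hP, h Nf hNf reg hms m hm z shift T hA hN hG hP⟩
  exact ⟨key 2 (Or.inl rfl), key 3 (Or.inr rfl)⟩

/-- The unrestricted pointwise handover is the threshold-`0` case. [folklore] -/
theorem aboveThreshold_of_pointwise : HandoverPointwise → HandoverAboveThreshold :=
  fun h => ⟨0, le_rfl, fun Nf hNf reg hms m hm => h Nf hNf reg hms m hm⟩


/-! ## §6 (cycle 2) Same-regularisation analysis: the lattice gap clause is decided by `(reg, m)` alone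

The conclusion `QCD` re-quantifies `∃ reg`, so a prover may discard X₀'s regularisation; if he KEEPS
it (the informal mechanism does: "for the same scheme"), the two gap clauses separate cleanly:
`HasLatticeMassGap` never reads `z, shift, T` (`hasLatticeMassGap_scheme_indep`), so the lattice half
of a same-regularisation proof is a statement about lattice QCD along X₀'s bare trajectory ALONE
(`SameRegLatticeGap`), towards which X₀ hands over nothing lattice-side except `HasMassScaling`,
asymptotic scaling, the physical-branch condition and the bare existence + non-triviality of the
continuum limit (`sameReg_iff`). -/

/-- The lattice gap clause does not see the species data `z, shift` (nor `T`): it reads only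
`β_k, L_k, a_k, m_f(k)` of the scheme. [folklore] -/
theorem hasLatticeMassGap_scheme_indep {Nf : ℕ} (reg : QCDRegularisation Nf) (m : Fin Nf → ℝ)
    (z shift z' shift' : QCDField Nf → ℕ → ℝ) (Δ : ℝ) :
    (reg.scheme m z shift).HasLatticeMassGap Δ ↔ (reg.scheme m z' shift').HasLatticeMassGap Δ :=
  Iff.rfl

/-- The lattice-gap content of the conclusion at `(reg, m)`: some `Δ > 0` gaps lattice QCD along the
bare trajectory `m_f(k) = m_crit(k) + a_k m_f / Z_m(k)` uniformly in the volume. -/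
def LatticeGapped {Nf : ℕ} (reg : QCDRegularisation Nf) (m : Fin Nf → ℝ) : Prop :=
  ∃ Δ > 0, (reg.scheme m 0 0).HasLatticeMassGap Δ

/-- What X₀ says about ITS regularisation (the `∃ reg` body of `ContinuumQCDExists` at one `N_f`). -/
def IsTargetReg {Nf : ℕ} (reg : QCDRegularisation Nf) : Prop :=
  reg.HasMassScaling ∧ ∀ m : Fin Nf → ℝ, (∀ f, 0 < m f) →
    ∃ (z shift : QCDField Nf → ℕ → ℝ) (T : OSData (QCDField Nf) 4),
      IsQCDAlong (reg.scheme m z shift) T ∧ T.IsNontrivial QCDField.glue ∧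
        T.IsNonGaussian QCDField.glue ∧ ∀ f g : Fin Nf, f ≠ g → T.IsNontrivial (QCDField.pseudoRe f g)

/-- X₀ at one flavour number. -/
def ContinuumQCDExistsOf (Nf : ℕ) : Prop :=
  ∃ reg : QCDRegularisation Nf, IsTargetReg reg

/-- `ContinuumQCDExists` is the conjunction of its `N_f = 2` and `N_f = 3` components. [folklore] -/
theorem continuumQCDExists_iff_of :
    ContinuumQCDExists ↔ ∀ Nf : ℕ, Nf = 2 ∨ Nf = 3 → ContinuumQCDExistsOf Nf :=
  Iff.rfl

/-- **SAME-REGULARISATION HANDOVER**: keep X₀'s `reg`, re-choose `(z, shift, T)` per mass tuple, and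
deliver both gap clauses. Between `HandoverPointwise` and the crux (`sameReg_of_pointwise`,
`handover_of_sameReg`). -/
def HandoverSameReg : Prop :=
  ∀ Nf : ℕ, Nf = 2 ∨ Nf = 3 → ∀ reg : QCDRegularisation Nf, IsTargetReg reg →
    ∀ m : Fin Nf → ℝ, (∀ f, 0 < m f) →
      ∃ (z shift : QCDField Nf → ℕ → ℝ) (T : OSData (QCDField Nf) 4),
        IsQCDAlong (reg.scheme m z shift) T ∧ T.IsNontrivial QCDField.glue ∧
          T.IsNonGaussian QCDField.glue ∧
            (∀ f g : Fin Nf, f ≠ g → T.IsNontrivial (QCDField.pseudoRe f g)) ∧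
              ∃ Δ > 0, T.HasMassGap Δ ∧ (reg.scheme m z shift).HasLatticeMassGap Δ

/-- The continuum half of a same-regularisation proof. -/
def SameRegContinuumGap : Prop :=
  ∀ Nf : ℕ, Nf = 2 ∨ Nf = 3 → ∀ reg : QCDRegularisation Nf, IsTargetReg reg →
    ∀ m : Fin Nf → ℝ, (∀ f, 0 < m f) →
      ∃ (z shift : QCDField Nf → ℕ → ℝ) (T : OSData (QCDField Nf) 4),
        IsQCDAlong (reg.scheme m z shift) T ∧ T.IsNontrivial QCDField.glue ∧
          T.IsNonGaussian QCDField.glue ∧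
            (∀ f g : Fin Nf, f ≠ g → T.IsNontrivial (QCDField.pseudoRe f g)) ∧ ∃ Δ > 0, T.HasMassGap Δ

/-- The lattice half of a same-regularisation proof: lattice QCD along EVERY X₀-admissible
regularisation is gapped at every positive mass tuple — a statement in which `T`, `z`, `shift` do
not occur. -/
def SameRegLatticeGap : Prop :=
  ∀ Nf : ℕ, Nf = 2 ∨ Nf = 3 → ∀ reg : QCDRegularisation Nf, IsTargetReg reg →
    ∀ m : Fin Nf → ℝ, (∀ f, 0 < m f) → LatticeGapped reg m

/-- The pointwise handover implies the same-regularisation handover. [folklore] -/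
theorem sameReg_of_pointwise : HandoverPointwise → HandoverSameReg := by
  intro h Nf hNf reg hreg m hm
  obtain ⟨hms, hb⟩ := hreg
  obtain ⟨z, shift, T, hA, hN, hG, hP⟩ := hb m hm
  exact ⟨z, shift, T, hA, hN, hG, hP, h Nf hNf reg hms m hm z shift T hA hN hG hP⟩

/-- The same-regularisation handover implies the crux. [folklore] -/
theorem handover_of_sameReg : HandoverSameReg → RobustYangMillsHandover := by
  intro h hX
  have key : ∀ Nf, (Nf = 2 ∨ Nf = 3) → QCDOf Nf := by
    intro Nf hNf
    obtain ⟨reg, hreg⟩ := hX Nf hNf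
    exact ⟨reg, hreg.1, fun m hm => h Nf hNf reg hreg m hm⟩
  exact ⟨key 2 (Or.inl rfl), key 3 (Or.inr rfl)⟩

/-- `HasMassGap` is monotone: a gap `Δ'` is a gap `Δ ≤ Δ'`. [folklore] -/
theorem hasMassGap_anti {ι : Type} {d : ℕ} [NeZero d] (T : OSData ι d) {Δ Δ' : ℝ} (hle : Δ ≤ Δ')
    (h : T.HasMassGap Δ') : T.HasMassGap Δ := by
  intro n m k k' F G hF hG
  obtain ⟨C, hC⟩ := h n m k k' F G hF hG
  refine ⟨C, fun t ht H hH => (hC t ht H hH).trans ?_⟩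
  have hC0 : 0 ≤ C := by
    have h1 := (norm_nonneg _).trans (hC t ht H hH)
    exact nonneg_of_mul_nonneg_left h1 (Real.exp_pos _)
  exact mul_le_mul_of_nonneg_left (Real.exp_le_exp.mpr (by nlinarith)) hC0

/-- `HasLatticeMassGap` is monotone: a lattice gap `Δ'` is a lattice gap `Δ ≤ Δ'`. [folklore] -/
theorem hasLatticeMassGap_anti {Nf : ℕ} (sch : QCDScheme Nf) {Δ Δ' : ℝ} (hle : Δ ≤ Δ')
    (h : sch.HasLatticeMassGap Δ') : sch.HasLatticeMassGap Δ := by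
  intro R R' A B
  obtain ⟨C, hC⟩ := h R R' A B
  refine ⟨C, ?_⟩
  filter_upwards [hC] with k hk S hS n hn
  refine (hk S hS n hn).trans ?_
  have hC0 : 0 ≤ C := by
    have h1 := (norm_nonneg _).trans (hk S hS n hn)
    exact nonneg_of_mul_nonneg_left h1 (Real.exp_pos _)
  refine mul_le_mul_of_nonneg_left (Real.exp_le_exp.mpr ?_) hC0
  have : 0 ≤ sch.a k * n := mul_nonneg (sch.a_pos k).le (Nat.cast_nonneg n)
  nlinarith

/-- **The two gap clauses separate.** A same-regularisation proof is exactly a continuum-gap proof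
for (the re-chosen) `T` plus a lattice-gap proof about `(reg, m)` alone; the common `Δ` is the minimum.
[folklore] -/
theorem sameReg_iff : HandoverSameReg ↔ SameRegContinuumGap ∧ SameRegLatticeGap := by
  constructor
  · intro h
    refine ⟨fun Nf hNf reg hreg m hm => ?_, fun Nf hNf reg hreg m hm => ?_⟩
    · obtain ⟨z, shift, T, hA, hN, hG, hP, Δ, hΔ, hT, -⟩ := h Nf hNf reg hreg m hm
      exact ⟨z, shift, T, hA, hN, hG, hP, Δ, hΔ, hT⟩
    · obtain ⟨z, shift, T, -, -, -, -, Δ, hΔ, -, hL⟩ := h Nf hNf reg hreg m hm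
      exact ⟨Δ, hΔ, (hasLatticeMassGap_scheme_indep reg m z shift 0 0 Δ).mp hL⟩
  · rintro ⟨hc, hl⟩ Nf hNf reg hreg m hm
    obtain ⟨z, shift, T, hA, hN, hG, hP, Δ₁, hΔ₁, hT⟩ := hc Nf hNf reg hreg m hm
    obtain ⟨Δ₂, hΔ₂, hL⟩ := hl Nf hNf reg hreg m hm
    refine ⟨z, shift, T, hA, hN, hG, hP, min Δ₁ Δ₂, lt_min hΔ₁ hΔ₂,
      hasMassGap_anti T (min_le_left _ _) hT, ?_⟩
    exact (hasLatticeMassGap_scheme_indep reg m 0 0 z shift _).mp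
      (hasLatticeMassGap_anti _ (min_le_right _ _) hL)

/-- **Reading for provers (lattice half).** Any same-regularisation proof of the crux proves, in
passing, that lattice QCD along every X₀-admissible bare trajectory is gapped uniformly in the
volume — with no continuum datum in the statement. [folklore] -/
theorem latticeGapped_of_sameReg (h : HandoverSameReg) {Nf : ℕ} (hNf : Nf = 2 ∨ Nf = 3)
    (reg : QCDRegularisation Nf) (hreg : IsTargetReg reg) (m : Fin Nf → ℝ) (hm : ∀ f, 0 < m f) :
    LatticeGapped reg m :=
  (sameReg_iff.mp h).2 Nf hNf reg hreg m hm

/-! ## §7 (cycle 2) Per-flavour split and the sharpened `¬`-form -/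

/-- The crux follows from the per-flavour handovers `X₀(N_f) → QCDOf N_f`, `N_f = 2, 3` (it is the
weaker cross-flavour glue: its antecedent supplies BOTH components). [folklore] -/
theorem handover_of_perFlavour :
    (∀ Nf : ℕ, Nf = 2 ∨ Nf = 3 → ContinuumQCDExistsOf Nf → QCDOf Nf) → RobustYangMillsHandover :=
  fun h hX => ⟨h 2 (Or.inl rfl) (hX 2 (Or.inl rfl)), h 3 (Or.inr rfl) (hX 3 (Or.inr rfl))⟩

/-- Sharpened `¬`-form: a refutation needs BOTH continuum constructions (`N_f = 2` and `3`) and the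
failure of (at least) ONE gap statement. [folklore] -/
theorem not_handover_iff' : ¬ RobustYangMillsHandover ↔
    ContinuumQCDExistsOf 2 ∧ ContinuumQCDExistsOf 3 ∧ (¬ QCDOf 2 ∨ ¬ QCDOf 3) := by
  rw [not_handover_iff]
  constructor
  · rintro ⟨hX, hQ⟩
    refine ⟨hX 2 (Or.inl rfl), hX 3 (Or.inr rfl), ?_⟩
    by_contra h
    obtain ⟨h2, h3⟩ := not_or.mp h
    exact hQ ⟨not_not.mp h2, not_not.mp h3⟩
  · rintro ⟨h2, h3, hQ⟩
    refine ⟨fun Nf hNf => ?_, fun q => hQ.elim (fun h => h q.1) (fun h => h q.2)⟩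
    rcases hNf with rfl | rfl
    · exact h2
    · exact h3

/-! ## §8 (cycle 2) Threshold form of the ANTECEDENT: X₀, too, only speaks above an unpinned offset -/

/-- X₀ at one `N_f`, restricted to mass tuples above a threshold `M₀`. -/
def ContinuumQCDExistsAbove (Nf : ℕ) (M₀ : ℝ) : Prop :=
  ∃ reg : QCDRegularisation Nf, reg.HasMassScaling ∧ ∀ m : Fin Nf → ℝ, (∀ f, M₀ < m f) →
    ∃ (z shift : QCDField Nf → ℕ → ℝ) (T : OSData (QCDField Nf) 4),
      IsQCDAlong (reg.scheme m z shift) T ∧ T.IsNontrivial QCDField.glue ∧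
        T.IsNonGaussian QCDField.glue ∧ ∀ f g : Fin Nf, f ≠ g → T.IsNontrivial (QCDField.pseudoRe f g)

/-- **Threshold reading of the antecedent** (the X₀-twin of the tree's `qcdOf_iff_threshold`):
`X₀(N_f) ↔ ∃ M₀ ≥ 0, X₀(N_f) above M₀` — shift `m_crit(k) ↦ m_crit(k) + a_k M₀ / Z_m(k)`. So the
HANDED-OVER family, like the conclusion, covers "all masses above a witness-dependent offset", and the
two offsets are logically independent: the crux is `(∃ M₀, X₀ above M₀) → (∃ M₀', QCD above M₀')`.
[folklore] -/
theorem continuumQCDExistsOf_iff_threshold (Nf : ℕ) :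
    ContinuumQCDExistsOf Nf ↔ ∃ M₀ : ℝ, 0 ≤ M₀ ∧ ContinuumQCDExistsAbove Nf M₀ := by
  constructor
  · rintro ⟨reg, hms, h⟩
    exact ⟨0, le_rfl, reg, hms, h⟩
  · rintro ⟨M₀, -, reg, hms, h⟩
    refine ⟨{ reg with mcrit := fun k => reg.mcrit k + reg.a k * M₀ / reg.Zm k }, hms, fun m hm => ?_⟩
    obtain ⟨z, shift, T, hQ, hN, hG, hP⟩ := h (fun f => M₀ + m f) (fun f => by linarith [hm f])
    refine ⟨z, shift, T, ?_, hN, hG, hP⟩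
    rwa [Theorems.GluonicCompletion.Negative.scheme_mcrit_shift]

/-- Raising the threshold of the antecedent is free (restriction). [folklore] -/
theorem continuumQCDExistsAbove_mono {Nf : ℕ} {M₀ M₁ : ℝ} (hle : M₀ ≤ M₁) :
    ContinuumQCDExistsAbove Nf M₀ → ContinuumQCDExistsAbove Nf M₁ := by
  rintro ⟨reg, hms, h⟩
  exact ⟨reg, hms, fun m hm => h m fun f => lt_of_le_of_lt hle (hm f)⟩

/-- **The crux in pure threshold form**: `(∀ N_f ∈ {2,3}, ∃ M₀ ≥ 0, X₀ above M₀) → QCD`, where `QCD`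
itself is `∃ M₀' ≥ 0, …` by `qcdOf_iff_threshold`. [folklore] -/
theorem handover_iff_thresholdForm : RobustYangMillsHandover ↔
    ((∀ Nf : ℕ, Nf = 2 ∨ Nf = 3 → ∃ M₀ : ℝ, 0 ≤ M₀ ∧ ContinuumQCDExistsAbove Nf M₀) → _root_.QCD) := by
  have e : ContinuumQCDExists ↔ ∀ Nf : ℕ, Nf = 2 ∨ Nf = 3 → ∃ M₀ : ℝ, 0 ≤ M₀ ∧ ContinuumQCDExistsAbove Nf M₀ :=
    forall₂_congr fun Nf _ => continuumQCDExistsOf_iff_threshold Nf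
  unfold RobustYangMillsHandover
  rw [e]

/-! ## §9 (cycle 2) Audit of the informal mechanism — two checkable corrections

(i) "`δS` … with norm `η(j*) → 0` as `k → ∞`": at a FIXED physical handover scale `μ* = 1/ℓ₀` the
heavy-quark effective action converges (with the continuum limit) to a `k`-INDEPENDENT non-zero
functional; its marginal part is the quark-loop shift of the inverse coupling,
`Δβ = 2 (b₀(0) − b₀(N_f)) log(1/(a²M²))`, which DIVERGES logarithmically in the cutoff
(`quarkLoopShift_tendsto_atTop`; it is what the sibling route's `CouplingMatching` absorbs into
`β_eff`), and the remainder is irrelevant, `O((μ*/M)²)` by decoupling — small for `μ* ≪ M`, never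
`→ 0` in `k`. So ROBUST YM must tolerate (a) an `O(log)` re-tuning of `β` (handled only by
β-universality, `YMLatticeGapAlongAFSequences`-type hypotheses) and (b) quasi-local perturbations of
a FIXED small size `η(K)`, `K = M/μ*` — an openness statement with a fixed small parameter.
(ii) "numerical range of the … effective Dirac operator `≥ c > 0`, AccretiveWilsonDirac-type
coercivity of the TUNED flow": along X₀'s bare trajectory the fine-lattice bare masses are eventually
NEGATIVE whenever the witness's `m_crit` is honestly negative (`scheme_mq_eventually_neg`: `Z_m → ∞`
by `HasMassScaling`, so `a_k m_f / Z_m(k) → 0` cannot compensate `m_crit(k) ≤ −δ`; realistic one-loop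
form `scheme_mq_eventually_neg_of_logBound`: `m_crit(k) ≤ −c/log(1/a_k²)` suffices, Montvay–Münster
(5.62) `a m_cr = −0.434 g₀² + O(g₀⁴)` — the increment is `o(1/log)` by `tendsto_a_mul_log_inv_sq`), and
then the accretivity bound `Re⟨v, D_W v⟩ ≥ m‖v‖²` is void: coercivity can only be a property of a
BLOCKED operator below the quark scale (the content of the informal `HeavyBlockIntegration`, not of
the tree's `wilsonDirac` at the scheme's bare mass). In the heavy/strong-coupling direction the
leading effect of the quark determinant is likewise a SHIFT of `β` (Montvay–Münster (5.34)–(5.35),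
`Δβ = 24K⁴N_f(1 + 2r² − r⁴)`, page-verified p.231), consistent with (i). -/

/-- The quark-loop coefficient: `b₀(0) − b₀(N_f) = N_f / (24π²)`. [folklore] -/
theorem betaCoeff₀_zero_sub (Nf : ℕ) : betaCoeff₀ 0 - betaCoeff₀ Nf = (Nf : ℝ) / (24 * Real.pi ^ 2) := by
  have hπ : Real.pi ^ 2 ≠ 0 := by positivity
  simp only [betaCoeff₀]
  field_simp
  push_cast
  ring

/-- **(i) The marginal part of the heavy-quark `δS` diverges in the cutoff.** For `N_f ≥ 1` and
`M > 0`, the one-loop quark contribution to the tree's inverse bare coupling between cutoff `a` and the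
quark scale `1/M`, `2 (b₀(0) − b₀(N_f)) log(1/(a²M²))`, tends to `+∞` as `a → 0⁺`. [folklore] -/
theorem quarkLoopShift_tendsto_atTop (Nf : ℕ) (hNf : Nf ≠ 0) {M : ℝ} (hM : 0 < M) :
    Tendsto (fun a : ℝ => 2 * (betaCoeff₀ 0 - betaCoeff₀ Nf) * Real.log (1 / (a ^ 2 * M ^ 2)))
      (𝓝[>] 0) atTop := by
  have hc : 0 < 2 * (betaCoeff₀ 0 - betaCoeff₀ Nf) := by
    rw [betaCoeff₀_zero_sub]
    have : (0 : ℝ) < Nf := by exact_mod_cast Nat.pos_of_ne_zero hNf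
    positivity
  refine Tendsto.const_mul_atTop hc ?_
  -- `1/(a² M²) → +∞` as `a → 0⁺`
  have h1 : Tendsto (fun a : ℝ => a ^ 2 * M ^ 2) (𝓝[>] 0) (𝓝[>] 0) := by
    refine tendsto_nhdsWithin_iff.mpr ⟨?_, ?_⟩
    · have : Tendsto (fun a : ℝ => a ^ 2 * M ^ 2) (𝓝 0) (𝓝 (0 ^ 2 * M ^ 2)) :=
        ((continuous_pow 2).mul continuous_const).tendsto 0
      simpa using this.mono_left nhdsWithin_le_nhds
    · filter_upwards [self_mem_nhdsWithin] with a ha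
      exact mul_pos (pow_pos ha 2) (pow_pos hM 2)
  have h2 : Tendsto (fun a : ℝ => (a ^ 2 * M ^ 2)⁻¹) (𝓝[>] 0) atTop := h1.inv_tendsto_nhdsGT_zero
  exact (Real.tendsto_log_atTop.comp h2).congr fun a => by simp only [Function.comp_apply, one_div]

/-- `γ₀/(2β₀) > 0` below the asymptotic-freedom bound (`N_f ≤ 16`). [folklore] -/
theorem massExponent_pos {Nf : ℕ} (hNf : Nf ≤ 16) : 0 < massExponent Nf := by
  have hNf' : (Nf : ℝ) ≤ 16 := by exact_mod_cast hNf
  have hb : 0 < betaCoeff₀ Nf := by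
    simp only [betaCoeff₀]
    apply div_pos _ (by positivity)
    linarith
  have hg : 0 < gammaCoeff₀ := by simp only [gammaCoeff₀]; positivity
  simp only [massExponent]
  positivity

/-- `HasMassScaling` forces `Z_m(k) → ∞` (for `N_f ≤ 16`). [folklore] -/
theorem tendsto_Zm_atTop {Nf : ℕ} (hNf : Nf ≤ 16) (reg : QCDRegularisation Nf)
    (hms : reg.HasMassScaling) : Tendsto reg.Zm atTop atTop := by
  obtain ⟨c, hc, h⟩ := hms
  -- `log(1/a_k²) → +∞`
  have ha2 : Tendsto (fun k => reg.a k ^ 2) atTop (𝓝[>] 0) := by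
    refine tendsto_nhdsWithin_iff.mpr ⟨?_, Eventually.of_forall fun k => pow_pos (reg.a_pos k) 2⟩
    simpa using (reg.tendsto_a.pow 2)
  have hlog : Tendsto (fun k => Real.log (1 / reg.a k ^ 2)) atTop atTop :=
    (Real.tendsto_log_atTop.comp ha2.inv_tendsto_nhdsGT_zero).congr fun k => by
      simp only [Function.comp_apply, Pi.inv_apply, one_div]
  have hpow : Tendsto (fun k => Real.log (1 / reg.a k ^ 2) ^ massExponent Nf) atTop atTop :=
    (tendsto_rpow_atTop (massExponent_pos hNf)).comp hlog
  have key : Tendsto (fun k => reg.Zm k / Real.log (1 / reg.a k ^ 2) ^ massExponent Nf *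
      Real.log (1 / reg.a k ^ 2) ^ massExponent Nf) atTop atTop :=
    h.pos_mul_atTop hc hpow
  refine key.congr' ?_
  filter_upwards [hpow.eventually_gt_atTop 0] with k hk
  rw [div_mul_cancel₀ _ hk.ne']

/-- **(ii) The handed-over bare trajectory is eventually NEGATIVE** when the witness's critical
mass is honestly negative: if `m_crit(k) ≤ −δ < 0` eventually then, by `HasMassScaling`
(`Z_m → ∞`, `a_k → 0`), every bare mass `m_f(k) = m_crit(k) + a_k m_f / Z_m(k)` of the scheme is
eventually `< −δ/2`, whatever `z, shift`. (The Wilson `r = 1` critical line has `m_c(β) < 0` at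
every `β < ∞`, `κ_c > 1/8`, but `m_c(β_k) → 0⁻` only logarithmically along an a.f. sequence — see the
one-loop form `scheme_mq_eventually_neg_of_logBound` below for the realistic hypothesis; either way the
accretivity bound `Re⟨v, D_W v⟩ ≥ m‖v‖²` is void at the scheme's bare mass.) [folklore] -/
theorem scheme_mq_eventually_neg {Nf : ℕ} (hNf : Nf ≤ 16) (reg : QCDRegularisation Nf)
    (hms : reg.HasMassScaling) {δ : ℝ} (hδ : 0 < δ) (hcrit : ∀ᶠ k in atTop, reg.mcrit k ≤ -δ)
    (m : Fin Nf → ℝ) (z shift : QCDField Nf → ℕ → ℝ) (f : Fin Nf) :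
    ∀ᶠ k in atTop, (reg.scheme m z shift).mq f k < -δ / 2 := by
  have hZ := tendsto_Zm_atTop hNf reg hms
  have h0 : Tendsto (fun k => reg.a k * m f / reg.Zm k) atTop (𝓝 0) := by
    have h1 : Tendsto (fun k => reg.a k * m f) atTop (𝓝 (0 * m f)) := reg.tendsto_a.mul_const _
    rw [zero_mul] at h1
    simpa [div_eq_mul_inv] using h1.mul hZ.inv_tendsto_atTop
  filter_upwards [hcrit, (tendsto_order.mp h0).2 (δ / 2) (by linarith)] with k hk hk'
  rw [QCDRegularisation.scheme_mq]
  linarith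

/-- `a_k log(1/a_k²) → 0` along any regularisation (`x log x → 0`). [folklore] -/
theorem tendsto_a_mul_log_inv_sq {Nf : ℕ} (reg : QCDRegularisation Nf) :
    Tendsto (fun k => reg.a k * Real.log (1 / reg.a k ^ 2)) atTop (𝓝 0) := by
  have ha : Tendsto reg.a atTop (𝓝[>] 0) :=
    tendsto_nhdsWithin_iff.mpr ⟨reg.tendsto_a, Eventually.of_forall fun k => reg.a_pos k⟩
  have h1 : Tendsto (fun k => Real.log (reg.a k) * reg.a k ^ (1 : ℝ)) atTop (𝓝 0) :=
    (tendsto_log_mul_rpow_nhdsGT_zero zero_lt_one).comp ha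
  have h2 : Tendsto (fun k => -2 * (Real.log (reg.a k) * reg.a k ^ (1 : ℝ))) atTop (𝓝 (-2 * 0)) :=
    h1.const_mul _
  rw [mul_zero] at h2
  refine h2.congr fun k => ?_
  rw [Real.rpow_one, one_div, Real.log_inv, Real.log_pow]
  push_cast
  ring

/-- **(ii′) One-loop form of (ii).** If the witness's critical mass lies (at least) one-loop deep
below zero, `m_crit(k) ≤ −c / log(1/a_k²)` eventually for some `c > 0` (Montvay–Münster (5.62):
`K_cr = ⅛(1 + 0.1085 g₀² + …)`, i.e. `a m_cr = −0.434 g₀² + O(g₀⁴)` for `SU(3)`, `r = 1`; `g₀² = 2/β`,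
`β_k ≈ 2b₀ log(1/(a_k²Λ²))`), then — although `m_crit(k) → 0⁻` — every bare mass of the handed-over
trajectory is still eventually NEGATIVE: by `HasMassScaling` the increment `a_k m_f / Z_m(k)` is
`o(1/log(1/a_k²))`. [cite: MontvayMunster1994, §5.1 (5.62)] -/
theorem scheme_mq_eventually_neg_of_logBound {Nf : ℕ} (hNf : Nf ≤ 16) (reg : QCDRegularisation Nf)
    (hms : reg.HasMassScaling) {c : ℝ} (hc : 0 < c)
    (hcrit : ∀ᶠ k in atTop, reg.mcrit k ≤ -(c / Real.log (1 / reg.a k ^ 2)))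
    (m : Fin Nf → ℝ) (z shift : QCDField Nf → ℕ → ℝ) (f : Fin Nf) :
    ∀ᶠ k in atTop, (reg.scheme m z shift).mq f k < 0 := by
  have hZ := tendsto_Zm_atTop hNf reg hms
  have h0 : Tendsto (fun k => reg.a k * Real.log (1 / reg.a k ^ 2) * m f / reg.Zm k) atTop (𝓝 0) := by
    have h1 : Tendsto (fun k => reg.a k * Real.log (1 / reg.a k ^ 2) * m f) atTop (𝓝 (0 * m f)) :=
      (tendsto_a_mul_log_inv_sq reg).mul_const _
    rw [zero_mul] at h1
    simpa [div_eq_mul_inv] using h1.mul hZ.inv_tendsto_atTop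
  have ha2 : Tendsto (fun k => reg.a k ^ 2) atTop (𝓝[>] 0) := by
    refine tendsto_nhdsWithin_iff.mpr ⟨?_, Eventually.of_forall fun k => pow_pos (reg.a_pos k) 2⟩
    simpa using (reg.tendsto_a.pow 2)
  have hlog : Tendsto (fun k => Real.log (1 / reg.a k ^ 2)) atTop atTop :=
    (Real.tendsto_log_atTop.comp ha2.inv_tendsto_nhdsGT_zero).congr fun k => by
      simp only [Function.comp_apply, Pi.inv_apply, one_div]
  filter_upwards [hcrit, (tendsto_order.mp h0).2 c hc, hlog.eventually_gt_atTop 0] with k hk hk' hL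
  rw [QCDRegularisation.scheme_mq]
  have key : reg.a k * m f / reg.Zm k < c / Real.log (1 / reg.a k ^ 2) := by
    rw [lt_div_iff₀ hL]
    calc reg.a k * m f / reg.Zm k * Real.log (1 / reg.a k ^ 2)
        = reg.a k * Real.log (1 / reg.a k ^ 2) * m f / reg.Zm k := by ring
      _ < c := hk'
  linarith

/-! ## §10 (cycle 2) Tightness: the free Wilson–Dirac operator's constant modes sit at the bare mass

(b)-type lemma for §9(ii): for `U ≡ 1` and every site-constant colour–spin vector `v(x,a,α) = w(a,α)`
the tree's `wilsonDirac ρ 1 m r` acts as multiplication by `m` (`wilsonDirac_one_mulVec_const`), so the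
accretivity bound of the route's support item `AccretiveWilsonDirac` (8875) is ATTAINED
(`accretivity_tight`, `accretiveWilsonDirac_tight_su3`) and at a negative bare mass the numerical
range of the fine operator is negative (`numericalRange_neg_of_mass_neg`): together with
`scheme_mq_eventually_neg_of_logBound`, no coercivity `Re⟨v, D_W v⟩ ≥ c‖v‖²`, `c > 0`, holds for the
fine operator along the handed-over trajectory, even at the smoothest gauge field. (Landed:
`Negative/FreeWilsonModes.lean`, p75175.) -/

section FreeWilsonModes

open Literature.MathematicalPhysics.QuantumLattice Literature.Probability.LatticeModels Matrix Finset

variable {L N : ℕ} {G : Type*} [Group G] (ρ : G →* Matrix (Fin N) (Fin N) ℂ)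

/-- `p = q + e_μ ↔ q = p − e_μ` on the discrete torus. [folklore] -/
theorem eq_site_shift_iff (p q : TorusSite 4 L) (μ : Fin 4) :
    p = Literature.MathematicalPhysics.QuantumFieldTheory.Site.shift q μ ↔ q = p - Pi.single μ 1 := by
  simp only [Literature.MathematicalPhysics.QuantumFieldTheory.Site.shift]
  constructor
  · rintro rfl; simp
  · rintro rfl; simp

/-- At fixed spin row, forward `(r − γ_μ)` plus backward `(r + γ_μ)` contracted with a colour–spin
vector give `2r` times the vector. [folklore] -/
theorem hopPair_sum (r : ℝ) (μ : Fin 4) (w : Fin N × Fin 4 → ℂ) (p : TorusSite 4 L × Fin N × Fin 4) :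
    ∑ β : Fin 4, ((r : ℂ) • (1 : Matrix (Fin 4) (Fin 4) ℂ) - euclideanGamma μ) p.2.2 β * w (p.2.1, β) +
      ∑ β : Fin 4, ((r : ℂ) • (1 : Matrix (Fin 4) (Fin 4) ℂ) + euclideanGamma μ) p.2.2 β * w (p.2.1, β) =
      2 * (r : ℂ) * w p.2 := by
  rw [← Finset.sum_add_distrib]
  have : ∀ β : Fin 4, ((r : ℂ) • (1 : Matrix (Fin 4) (Fin 4) ℂ) - euclideanGamma μ) p.2.2 β * w (p.2.1, β) +
      ((r : ℂ) • (1 : Matrix (Fin 4) (Fin 4) ℂ) + euclideanGamma μ) p.2.2 β * w (p.2.1, β) =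
      if p.2.2 = β then 2 * (r : ℂ) * w (p.2.1, β) else 0 := by
    intro β
    simp only [Matrix.sub_apply, Matrix.add_apply, Matrix.smul_apply, Matrix.one_apply, smul_eq_mul]
    split_ifs <;> ring
  simp_rw [this]
  rw [Finset.sum_ite_eq]
  simp

variable [NeZero L]

/-- The forward hopping term of `wilsonDirac ρ 1 m r` on a site-constant vector collapses to the
spin matrix `(r − γ_μ)`. [folklore] -/
theorem wilsonHopFwd_one_sum (r : ℝ) (μ : Fin 4) (w : Fin N × Fin 4 → ℂ) (p : TorusSite 4 L × Fin N × Fin 4) :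
    ∑ x : TorusSite 4 L × Fin N × Fin 4,
      (if x.1 = Literature.MathematicalPhysics.QuantumFieldTheory.Site.shift p.1 μ then
        ((r : ℂ) • (1 : Matrix (Fin 4) (Fin 4) ℂ) - euclideanGamma μ) p.2.2 x.2.2 *
          (1 : Matrix (Fin N) (Fin N) ℂ) p.2.1 x.2.1 else 0) * w x.2 =
      ∑ β : Fin 4, ((r : ℂ) • (1 : Matrix (Fin 4) (Fin 4) ℂ) - euclideanGamma μ) p.2.2 β * w (p.2.1, β) := by
  rw [Fintype.sum_prod_type,
    Finset.sum_eq_single (Literature.MathematicalPhysics.QuantumFieldTheory.Site.shift p.1 μ)]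
  · simp only [if_true]
    rw [Fintype.sum_prod_type, Finset.sum_eq_single p.2.1]
    · simp [Matrix.one_apply]
    · intro b _ hb
      simp [Matrix.one_apply, Ne.symm hb]
    · simp
  · intro q1 _ hq1
    simp [hq1]
  · simp

/-- The backward hopping term of `wilsonDirac ρ 1 m r` on a site-constant vector collapses to the
spin matrix `(r + γ_μ)`. [folklore] -/
theorem wilsonHopBwd_one_sum (r : ℝ) (μ : Fin 4) (w : Fin N × Fin 4 → ℂ) (p : TorusSite 4 L × Fin N × Fin 4) :
    ∑ x : TorusSite 4 L × Fin N × Fin 4,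
      (if p.1 = Literature.MathematicalPhysics.QuantumFieldTheory.Site.shift x.1 μ then
        ((r : ℂ) • (1 : Matrix (Fin 4) (Fin 4) ℂ) + euclideanGamma μ) p.2.2 x.2.2 *
          (1 : Matrix (Fin N) (Fin N) ℂ) p.2.1 x.2.1 else 0) * w x.2 =
      ∑ β : Fin 4, ((r : ℂ) • (1 : Matrix (Fin 4) (Fin 4) ℂ) + euclideanGamma μ) p.2.2 β * w (p.2.1, β) := by
  simp_rw [eq_site_shift_iff]
  rw [Fintype.sum_prod_type, Finset.sum_eq_single (p.1 - Pi.single μ 1)]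
  · simp only [if_true]
    rw [Fintype.sum_prod_type, Finset.sum_eq_single p.2.1]
    · simp [Matrix.one_apply]
    · intro b _ hb
      simp [Matrix.one_apply, Ne.symm hb]
    · simp
  · intro q1 _ hq1
    simp [hq1]
  · simp

/-- **The free Wilson–Dirac operator's constant modes sit at the bare mass.** For the trivial gauge
field and every site-constant colour–spin vector `v(x, a, α) = w(a, α)`:
`(D_W(1, m, r) v)(x, a, α) = m · w(a, α)` — the `4r` of the diagonal cancels against the eight hops,
the `γ_μ` cancel between forward and backward hops. (The `p = 0` corner of the free symbol
`m + r Σ(1 − cos p_μ) + i Σ γ_μ sin p_μ`.) [folklore] -/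
theorem wilsonDirac_one_mulVec_const (m r : ℝ) (w : Fin N × Fin 4 → ℂ) (p : TorusSite 4 L × Fin N × Fin 4) :
    ((wilsonDirac ρ (1 : GaugeConfig 4 L G) m r) *ᵥ (fun q => w q.2)) p = (m : ℂ) * w p.2 := by
  simp only [Matrix.mulVec, dotProduct, wilsonDirac, Matrix.of_apply, Pi.one_apply, map_one, inv_one]
  simp_rw [sub_mul, Finset.sum_sub_distrib]
  have hdiag : ∑ x : TorusSite 4 L × Fin N × Fin 4, (if p = x then ((m + 4 * r : ℝ) : ℂ) else 0) * w x.2 =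
      ((m + 4 * r : ℝ) : ℂ) * w p.2 := by
    simp_rw [ite_mul, zero_mul]
    rw [Finset.sum_ite_eq]
    simp
  rw [hdiag]
  set F : TorusSite 4 L × Fin N × Fin 4 → Fin 4 → ℂ := fun x μ =>
    if x.1 = Literature.MathematicalPhysics.QuantumFieldTheory.Site.shift p.1 μ then
      ((r : ℂ) • (1 : Matrix (Fin 4) (Fin 4) ℂ) - euclideanGamma μ) p.2.2 x.2.2 *
        (1 : Matrix (Fin N) (Fin N) ℂ) p.2.1 x.2.1 else 0 with hF
  set B : TorusSite 4 L × Fin N × Fin 4 → Fin 4 → ℂ := fun x μ =>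
    if p.1 = Literature.MathematicalPhysics.QuantumFieldTheory.Site.shift x.1 μ then
      ((r : ℂ) • (1 : Matrix (Fin 4) (Fin 4) ℂ) + euclideanGamma μ) p.2.2 x.2.2 *
        (1 : Matrix (Fin N) (Fin N) ℂ) p.2.1 x.2.1 else 0 with hB
  have hstep : ∀ μ : Fin 4, ∑ x : TorusSite 4 L × Fin N × Fin 4, (F x μ + B x μ) * w x.2 =
      2 * (r : ℂ) * w p.2 := by
    intro μ
    simp_rw [add_mul, Finset.sum_add_distrib]
    rw [hF, hB]
    simp only
    rw [wilsonHopFwd_one_sum, wilsonHopBwd_one_sum, hopPair_sum]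
  have hhop : ∑ x : TorusSite 4 L × Fin N × Fin 4, (1 / 2 : ℂ) * (∑ μ : Fin 4, (F x μ + B x μ)) * w x.2 =
      (4 * r : ℂ) * w p.2 := by
    calc ∑ x : TorusSite 4 L × Fin N × Fin 4, (1 / 2 : ℂ) * (∑ μ : Fin 4, (F x μ + B x μ)) * w x.2
        = (1 / 2 : ℂ) * ∑ x : TorusSite 4 L × Fin N × Fin 4, ∑ μ : Fin 4, (F x μ + B x μ) * w x.2 := by
          rw [Finset.mul_sum]
          refine Finset.sum_congr rfl fun x _ => ?_
          rw [mul_assoc, Finset.sum_mul]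
      _ = (1 / 2 : ℂ) * ∑ μ : Fin 4, ∑ x : TorusSite 4 L × Fin N × Fin 4, (F x μ + B x μ) * w x.2 := by
          rw [Finset.sum_comm]
      _ = (1 / 2 : ℂ) * ∑ μ : Fin 4, 2 * (r : ℂ) * w p.2 := by
          simp_rw [hstep]
      _ = (4 * r : ℂ) * w p.2 := by
          simp only [Finset.sum_const, Finset.card_univ, Fintype.card_fin, nsmul_eq_mul]
          push_cast
          ring
  rw [hhop]
  push_cast
  ring

/-- Vector form: site-constant vectors are eigenvectors of `D_W(1, m, r)` with eigenvalue `m`.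
[folklore] -/
theorem wilsonDirac_one_mulVec_const_eq_smul (m r : ℝ) (w : Fin N × Fin 4 → ℂ) :
    (wilsonDirac ρ (1 : GaugeConfig 4 L G) m r) *ᵥ (fun q => w q.2) = (m : ℂ) • fun q => w q.2 := by
  ext p
  rw [wilsonDirac_one_mulVec_const]
  rfl

/-- **Tightness of the accretivity bound.** At `U ≡ 1`, on site-constant vectors, the quadratic
form of the Wilson–Dirac operator is EXACTLY `m‖v‖²` (the Wilson term `½Σ‖U v(x+μ̂) − v(x)‖²` of
`AccretiveWilsonDirac` vanishes): the bound `Re⟨v, D_W v⟩ ≥ m‖v‖²` cannot be improved uniformly in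
`U`. [folklore] -/
theorem accretivity_tight (m r : ℝ) (w : Fin N × Fin 4 → ℂ) :
    (∑ i, star ((fun q : TorusSite 4 L × Fin N × Fin 4 => w q.2) i) *
        ((wilsonDirac ρ (fun _ => 1 : GaugeConfig 4 L G) m r).mulVec (fun q => w q.2)) i).re =
      m * ∑ i : TorusSite 4 L × Fin N × Fin 4, ‖w i.2‖ ^ 2 := by
  have h1 : (fun _ => 1 : GaugeConfig 4 L G) = 1 := rfl
  rw [h1]
  simp_rw [wilsonDirac_one_mulVec_const]
  have : ∀ i : TorusSite 4 L × Fin N × Fin 4,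
      star (w i.2) * ((m : ℂ) * w i.2) = ((m * ‖w i.2‖ ^ 2 : ℝ) : ℂ) := by
    intro i
    rw [mul_left_comm, Complex.star_def, Complex.conj_mul']
    push_cast
    ring
  simp_rw [this]
  rw [← Complex.ofReal_sum, Complex.ofReal_re, Finset.mul_sum]

/-- **Negative numerical range at negative bare mass.** For `m < 0` the fine-lattice Wilson–Dirac
operator at the trivial (smoothest possible) gauge field has `Re⟨v, D_W v⟩ < 0` on every non-zero
site-constant vector: no coercivity `Re⟨v, D_W v⟩ ≥ c‖v‖²`, `c > 0`, can hold at the bare masses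
`m_f(k) < 0` of the handed-over trajectory (`scheme_mq_eventually_neg_of_logBound`). [folklore] -/
theorem numericalRange_neg_of_mass_neg (m r : ℝ) (hm : m < 0) (w : Fin N × Fin 4 → ℂ) (hw : w ≠ 0) :
    (∑ i, star ((fun q : TorusSite 4 L × Fin N × Fin 4 => w q.2) i) *
        ((wilsonDirac ρ (fun _ => 1 : GaugeConfig 4 L G) m r).mulVec (fun q => w q.2)) i).re < 0 := by
  rw [accretivity_tight]
  refine mul_neg_of_neg_of_pos hm ?_
  obtain ⟨j, hj⟩ : ∃ j, w j ≠ 0 := by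
    by_contra h
    push Not at h
    exact hw (funext h)
  have hle : ‖w j‖ ^ 2 ≤ ∑ i : TorusSite 4 L × Fin N × Fin 4, ‖w i.2‖ ^ 2 := by
    have := Finset.single_le_sum (f := fun i : TorusSite 4 L × Fin N × Fin 4 => ‖w i.2‖ ^ 2)
      (fun i _ => by positivity) (Finset.mem_univ ((0 : TorusSite 4 L), j))
    simpa using this
  have hpos : 0 < ‖w j‖ ^ 2 := by positivity
  linarith

/-- The route's setting (`SU(3)`, fundamental representation, `r = 1`): the exact LHS of
`AccretiveWilsonDirac` evaluated at `U ≡ 1` on a site-constant vector equals `m‖v‖²`. [folklore] -/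
theorem accretiveWilsonDirac_tight_su3 (m : ℝ) (w : Fin 3 × Fin 4 → ℂ) :
    (∑ i, star ((fun q : TorusSite 4 L × Fin 3 × Fin 4 => w q.2) i) *
        ((wilsonDirac (fundamentalRep (Fin 3))
          (fun _ => 1 : GaugeConfig 4 L (Matrix.specialUnitaryGroup (Fin 3) ℂ)) m 1).mulVec
            (fun q => w q.2)) i).re =
      m * ∑ i : TorusSite 4 L × Fin 3 × Fin 4, ‖w i.2‖ ^ 2 :=
  accretivity_tight _ m 1 w

end FreeWilsonModes

/-! ## §12 (cycle 3) The hopping window of the handed-over trajectory; tightness of the heavy-mass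
Neumann bound at `U ≡ 1`; transfer of the sign barriers to the massive conjunct

Self-contained copies (primed names) of `Theorems/RobustYangMillsHandover/Negative/HoppingWindow.lean`
(p76404). (A) `1/8 < κ_f(k) < 1/6` eventually; (B) `‖1 − (m+4)⁻¹ D_W(1,m,1)‖ = 4/(m+4)`, `≥ 1` iff
`m ≤ 0`, hopping series divergent on constant modes for `m ≤ 0`; (C) ordered, shrinking bare-mass
splitting and the `WilsonDeterminantMassSplitting` transfer. -/

section HoppingWindow

open Literature.MathematicalPhysics.QuantumLattice Literature.Probability.LatticeModels Matrix Finset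
open scoped Matrix.Norms.L2Operator

/-- `κ = 1/(2m+8) > 1/8 ↔ m < 0` (for `2m + 8 > 0`). [folklore] -/
theorem hoppingParam_gt_eighth_iff' {m : ℝ} (h : 0 < 2 * m + 8) :
    (1 : ℝ) / 8 < 1 / (2 * m + 8) ↔ m < 0 := by
  rw [one_div_lt_one_div (by norm_num) h]
  constructor <;> intro h' <;> linarith

/-- `κ = 1/(2m+8) < 1/6 ↔ −1 < m` (for `2m + 8 > 0`). [folklore] -/
theorem hoppingParam_lt_sixth_iff' {m : ℝ} (h : 0 < 2 * m + 8) :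
    1 / (2 * m + 8) < (1 : ℝ) / 6 ↔ -1 < m := by
  rw [one_div_lt_one_div h (by norm_num)]
  constructor <;> intro h' <;> linarith

/-- **(A) The hopping window** `1/8 < κ_f(k) < 1/6`, eventually, along the handed-over trajectory
(one-loop-deep critical mass, physical branch). [cite: MontvayMunster1994, §5.1.6 (5.62) and §4.2.3 (4.111)] -/
theorem scheme_hoppingParam_window' {Nf : ℕ} (hNf : Nf ≤ 16) (reg : QCDRegularisation Nf)
    (hms : reg.HasMassScaling) {c : ℝ} (hc : 0 < c)
    (hcrit : ∀ᶠ k in atTop, reg.mcrit k ≤ -(c / Real.log (1 / reg.a k ^ 2)))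
    (m : Fin Nf → ℝ) (z shift : QCDField Nf → ℕ → ℝ) (f : Fin Nf)
    (hbranch : ∀ᶠ k in atTop, -1 < (reg.scheme m z shift).mq f k) :
    ∀ᶠ k in atTop, (1 : ℝ) / 8 < 1 / (2 * (reg.scheme m z shift).mq f k + 8) ∧
      1 / (2 * (reg.scheme m z shift).mq f k + 8) < (1 : ℝ) / 6 := by
  filter_upwards [scheme_mq_eventually_neg_of_logBound hNf reg hms hc hcrit m z shift f, hbranch]
    with k hneg hgt
  have h8 : 0 < 2 * (reg.scheme m z shift).mq f k + 8 := by linarith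
  exact ⟨(hoppingParam_gt_eighth_iff' h8).2 hneg, (hoppingParam_lt_sixth_iff' h8).2 hgt⟩

/-- `1 ≤ 4/(m+4) ↔ m ≤ 0` (for `m + 4 > 0`). [folklore] -/
theorem one_le_hoppingRatio_iff' {m : ℝ} (h : 0 < m + 4) : 1 ≤ 4 / (m + 4) ↔ m ≤ 0 := by
  rw [le_div_iff₀ h]
  constructor <;> intro h' <;> linarith

variable {L N : ℕ} [NeZero L] {G : Type*} [Group G] (ρ : G →* Matrix (Fin N) (Fin N) ℂ)

/-- **(B) The hopping operator on constant modes at `U ≡ 1`** multiplies by `4/(m+4)`. [folklore] -/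
theorem hopOperator_one_mulVec_const (m : ℝ) (hm : m + 4 ≠ 0) (w : Fin N × Fin 4 → ℂ) :
    ((1 : Matrix _ _ ℂ) - ((m + 4 : ℝ) : ℂ)⁻¹ • wilsonDirac ρ (1 : GaugeConfig 4 L G) m 1) *ᵥ
        (fun q => w q.2) = ((4 / (m + 4) : ℝ) : ℂ) • fun q => w q.2 := by
  rw [Matrix.sub_mulVec, Matrix.smul_mulVec, Matrix.one_mulVec,
    wilsonDirac_one_mulVec_const_eq_smul ρ m 1 w, smul_smul]
  have hm' : ((m + 4 : ℝ) : ℂ) ≠ 0 := by exact_mod_cast hm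
  have : (1 : ℂ) - ((m + 4 : ℝ) : ℂ)⁻¹ * (m : ℂ) = ((4 / (m + 4) : ℝ) : ℂ) := by
    push_cast at hm' ⊢
    field_simp
    ring
  rw [← this, sub_smul, one_smul]

/-- Powers of the hopping operator on constant modes. [folklore] -/
theorem hopOperator_one_pow_mulVec_const (m : ℝ) (hm : m + 4 ≠ 0) (w : Fin N × Fin 4 → ℂ) (l : ℕ) :
    (((1 : Matrix _ _ ℂ) - ((m + 4 : ℝ) : ℂ)⁻¹ • wilsonDirac ρ (1 : GaugeConfig 4 L G) m 1) ^ l) *ᵥ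
        (fun q => w q.2) = (((4 / (m + 4)) ^ l : ℝ) : ℂ) • fun q => w q.2 := by
  induction l with
  | zero => simp
  | succ l ih =>
    rw [pow_succ, ← Matrix.mulVec_mulVec, hopOperator_one_mulVec_const ρ m hm w,
      Matrix.mulVec_smul, ih, smul_smul]
    push_cast
    ring_nf

/-- **(B) The heavy-mass Neumann bound is attained at `U ≡ 1`**: `4/(m+4) ≤ ‖1 − (m+4)⁻¹ D_W(1,m,1)‖`.
[cite: HernandezJansenLuscher1999, (2.14)] -/
theorem le_norm_hopOperator_one [NeZero N] (m : ℝ) (hm : 0 < m + 4) :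
    4 / (m + 4) ≤ ‖(1 : Matrix _ _ ℂ) - ((m + 4 : ℝ) : ℂ)⁻¹ • wilsonDirac ρ (1 : GaugeConfig 4 L G) m 1‖ := by
  set A := (1 : Matrix _ _ ℂ) - ((m + 4 : ℝ) : ℂ)⁻¹ • wilsonDirac ρ (1 : GaugeConfig 4 L G) m 1 with hA
  set v : TorusSite 4 L × Fin N × Fin 4 → ℂ := fun q => (fun _ : Fin N × Fin 4 => (1 : ℂ)) q.2 with hv
  set x : EuclideanSpace ℂ (TorusSite 4 L × Fin N × Fin 4) := WithLp.toLp 2 v with hx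
  have hAv : A *ᵥ v = ((4 / (m + 4) : ℝ) : ℂ) • v := hopOperator_one_mulVec_const ρ m hm.ne' (fun _ => 1)
  have hAx : ‖(WithLp.toLp 2 (A *ᵥ v) : EuclideanSpace ℂ _)‖ ≤ ‖A‖ * ‖x‖ := Matrix.l2_opNorm_mulVec A x
  have hx0 : 0 < ‖x‖ := by
    refine norm_pos_iff.mpr ?_
    intro h0
    have : v ((0 : TorusSite 4 L), (0 : Fin N), (0 : Fin 4)) = 0 := by
      have := congrArg (fun y : EuclideanSpace ℂ (TorusSite 4 L × Fin N × Fin 4) => y (0, 0, 0)) h0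
      simpa [hx] using this
    simp [hv] at this
  have hnorm : ‖(WithLp.toLp 2 (A *ᵥ v) : EuclideanSpace ℂ _)‖ = 4 / (m + 4) * ‖x‖ := by
    rw [hAv, WithLp.toLp_smul, norm_smul, Complex.norm_real, Real.norm_eq_abs,
      abs_of_nonneg (by positivity)]
  rw [hnorm] at hAx
  exact le_of_mul_le_mul_right hAx hx0

/-- The norm is exactly `4/(m+4)` at the trivial field. [cite: HernandezJansenLuscher1999, (2.14)] -/
theorem norm_hopOperator_one_eq [NeZero N] (hρ : ∀ g, ρ g ∈ Matrix.unitaryGroup (Fin N) ℂ)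
    (m : ℝ) (hm : 0 < m + 4) :
    ‖(1 : Matrix _ _ ℂ) - ((m + 4 : ℝ) : ℂ)⁻¹ • wilsonDirac ρ (1 : GaugeConfig 4 L G) m 1‖ = 4 / (m + 4) :=
  le_antisymm (norm_one_sub_smul_wilsonDirac_le ρ hρ 1 m hm) (le_norm_hopOperator_one ρ m hm)

/-- **No contraction at non-positive bare mass** (`−4 < m ≤ 0`). [folklore] -/
theorem one_le_norm_hopOperator_one [NeZero N] (m : ℝ) (hm : 0 < m + 4) (hm0 : m ≤ 0) :
    1 ≤ ‖(1 : Matrix _ _ ℂ) - ((m + 4 : ℝ) : ℂ)⁻¹ • wilsonDirac ρ (1 : GaugeConfig 4 L G) m 1‖ :=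
  ((one_le_hoppingRatio_iff' hm).2 hm0).trans (le_norm_hopOperator_one ρ m hm)

/-- **(B) The hopping series diverges on constant modes for `m ≤ 0`** (its terms do not tend to
`0`): Montvay–Münster (5.36) diverges at `κ ≥ 1/8` already on `U ≡ 1`. [cite: MontvayMunster1994, §5.1.3 (5.36)] -/
theorem hoppingSeries_term_not_tendsto_zero' (m : ℝ) (hm : 0 < m + 4) (hm0 : m ≤ 0)
    (w : Fin N × Fin 4 → ℂ) (p : TorusSite 4 L × Fin N × Fin 4) (hw : w p.2 ≠ 0) :
    ¬ Tendsto (fun l : ℕ =>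
        ((((1 : Matrix _ _ ℂ) - ((m + 4 : ℝ) : ℂ)⁻¹ • wilsonDirac ρ (1 : GaugeConfig 4 L G) m 1) ^ l) *ᵥ
          (fun q => w q.2)) p) atTop (𝓝 0) := by
  intro h
  have hq : 1 ≤ 4 / (m + 4) := (one_le_hoppingRatio_iff' hm).2 hm0
  have hterm : ∀ l : ℕ, ‖w p.2‖ ≤
      ‖((((1 : Matrix _ _ ℂ) - ((m + 4 : ℝ) : ℂ)⁻¹ • wilsonDirac ρ (1 : GaugeConfig 4 L G) m 1) ^ l) *ᵥ
          (fun q => w q.2)) p‖ := by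
    intro l
    rw [hopOperator_one_pow_mulVec_const ρ m hm.ne' w l, Pi.smul_apply, norm_smul,
      Complex.norm_real, Real.norm_eq_abs, abs_of_nonneg (by positivity)]
    have : (1 : ℝ) ≤ (4 / (m + 4)) ^ l := one_le_pow₀ hq
    nlinarith [norm_nonneg (w p.2)]
  have h0 : Tendsto (fun l : ℕ => ‖((((1 : Matrix _ _ ℂ) - ((m + 4 : ℝ) : ℂ)⁻¹ •
      wilsonDirac ρ (1 : GaugeConfig 4 L G) m 1) ^ l) *ᵥ (fun q => w q.2)) p‖) atTop (𝓝 0) := by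
    simpa using h.norm
  have := ge_of_tendsto' h0 (fun l => hterm l)
  exact hw (norm_le_zero_iff.mp this)

omit [NeZero L] in
/-- **(C) Bare-mass splitting** of the scheme: `m_g(k) − m_f(k) = a_k (m_g − m_f)/Z_m(k)`. [folklore] -/
theorem scheme_mq_sub' {Nf : ℕ} (reg : QCDRegularisation Nf) (m : Fin Nf → ℝ)
    (z shift : QCDField Nf → ℕ → ℝ) (f g : Fin Nf) (k : ℕ) :
    (reg.scheme m z shift).mq g k - (reg.scheme m z shift).mq f k = reg.a k * (m g - m f) / reg.Zm k := by
  simp only [QCDRegularisation.scheme_mq]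
  ring

omit [NeZero L] in
/-- Bare masses are ordered like renormalised masses at every step. [folklore] -/
theorem scheme_mq_lt_of_lt' {Nf : ℕ} (reg : QCDRegularisation Nf) (m : Fin Nf → ℝ)
    (z shift : QCDField Nf → ℕ → ℝ) {f g : Fin Nf} (hfg : m f < m g) (k : ℕ) :
    (reg.scheme m z shift).mq f k < (reg.scheme m z shift).mq g k := by
  have h := scheme_mq_sub' reg m z shift f g k
  have hpos : 0 < reg.a k * (m g - m f) / reg.Zm k :=
    div_pos (mul_pos (reg.a_pos k) (by linarith)) (reg.Zm_pos k)
  linarith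

omit [NeZero L] in
/-- The splitting tends to `0` in lattice units (`HasMassScaling`). [folklore] -/
theorem tendsto_scheme_mq_sub' {Nf : ℕ} (hNf : Nf ≤ 16) (reg : QCDRegularisation Nf)
    (hms : reg.HasMassScaling) (m : Fin Nf → ℝ) (z shift : QCDField Nf → ℕ → ℝ) (f g : Fin Nf) :
    Tendsto (fun k => (reg.scheme m z shift).mq g k - (reg.scheme m z shift).mq f k) atTop (𝓝 0) := by
  simp_rw [scheme_mq_sub']
  have hZ := tendsto_Zm_atTop hNf reg hms
  have h1 : Tendsto (fun k => reg.a k * (m g - m f)) atTop (𝓝 (0 * (m g - m f))) :=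
    reg.tendsto_a.mul_const _
  rw [zero_mul] at h1
  simpa [div_eq_mul_inv] using h1.mul hZ.inv_tendsto_atTop

/-- **(C) Barrier transfer.** A negative split two-flavour Wilson weight at step `k` forces an exact
zero mode of `D_W(U,·,1)` strictly between the bare masses `m_f(k) < m_g(k)` (catalogued
`WilsonDeterminantMassSplitting`, filed for ChiralRegime, applied on the massive trajectory).
[cite: MohlerSchaefer2020, §2.2 and §5.3] -/
theorem splitWeight_neg_imp_zeroMode_between' {Nf L' N' : ℕ} [NeZero L'] {G' : Type} [Group G']
    (ρ' : G' →* Matrix (Fin N') (Fin N') ℂ) (hρ : ∀ g, ρ' g ∈ Matrix.unitaryGroup (Fin N') ℂ)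
    (reg : QCDRegularisation Nf) (m : Fin Nf → ℝ) (z shift : QCDField Nf → ℕ → ℝ)
    {f g : Fin Nf} (hfg : m f < m g) (k : ℕ) (U : GaugeConfig 4 L' G')
    (hneg : ((wilsonDirac ρ' U ((reg.scheme m z shift).mq f k) 1).det *
        (wilsonDirac ρ' U ((reg.scheme m z shift).mq g k) 1).det).re < 0) :
    ∃ t ∈ Set.Ioo ((reg.scheme m z shift).mq f k) ((reg.scheme m z shift).mq g k),
      (wilsonDirac ρ' U t 1).det = 0 :=
  (Literature.Barriers.QuantumFields.WilsonDeterminantMassSplitting_holds L' N' G' ρ' hρ U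
      ((reg.scheme m z shift).mq f k) 1).2.1 _ (scheme_mq_lt_of_lt' reg m z shift hfg k) hneg

end HoppingWindow

/-! ## §13 (cycle 3) The shared stub `GapTransfer` (8923) of all four lines: a quantifier-order audit

All four `Lines/*.lean` on this crux (existence-pays-the-continuum-half, geometric-mean-handover,
low-mode-quarantine, threshold-irrelevance-squeeze) discharge the CONTINUUM gap clause through
`stub_gapTransfer : GradientFlowSpecies.GapTransfer`
(`IsQCDAlong sch T → sch.HasLatticeMassGap Δ → T.HasMassGap Δ'`, every `0 < Δ' < Δ`). Three observations
for the lead (no kill: the statement speaks about honest lattice QCD and is presumably true):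

1. `HasLatticeMassGap` is `∀ (A,B) ∃ C, ∀ᶠ k, …` — per observable pair, each with its own threshold
   `k₀(A,B)`. `T.HasMassGap Δ'` (`MassGapOS`) is clustering of ALL `(n+k)`-point functions on general
   time-ordered Schwartz tensors. At a fixed large `k` the objects to be bounded are k-DEPENDENT composites:
   smeared renormalised fields `Φ_k(f) = z(k) a_k⁴ Σ_x f(a_k x)(O(x) − shift)` (supports `~1/a_k` lattice
   units) and their time-ordered products at separations `~t/a_k`. No finite family of pairs covers them, so
   the per-pair clause does not transfer by "passing bounds to the limit"; that direct route fails formally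
   twice: (a) `|⟨Φ_k(f)Φ_k(g_t)⟩_c| ≤ z(k)² C ‖f‖₁‖g‖₁ e^{−Δt}` with `z(k) → ∞` for every non-trivially
   renormalised species; (b) the spatial offsets `τ_v⃗ O` are distinct observables with distinct
   `(C_v, k₀(v))`, `|v⃗| ≲ supp/a_k → ∞`.
2. The SPECTRAL route (the planner's) works for TWO-POINT clustering: for `k ≥ max_s k₀(θO_s, O_s)` over
   the finitely many species representatives, the spectral measure of `Ô_sΩ` for the transfer matrix lies
   in `{1} ∪ [0, e^{−a_kΔ}]`; that spectral subspace is invariant under spatial translations and `𝕋`, so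
   every smeared one-field vector `Φ̂_k(f)Ω` inherits it, with constant `‖Φ̂(f)Ω‖‖Φ̂(g)Ω‖` (convergent by
   `IsQCDAlong` + reflection positivity). For `(n+k) ≥ 3` the vectors `Φ̂(f₂)𝕋^{j}Φ̂(f₁)Ω`, `j ~ t/a_k`,
   lie in no subspace controlled by finitely many pairs: one needs the full-space gap at step `k`, i.e. the
   `∃ k₀ ∀ (A,B)` form, which `HasLatticeMassGap` (`∀ (A,B) ∃ k₀`) does not state. For honest lattice QCD
   the two forms presumably agree (a state below `Δ` at step `k` couples to some small loop) — physics, not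
   bookkeeping.
3. The transfer-matrix reading needs Lüscher positivity, `m_f(k) > −1` — granted by `IsQCDAlong` only
   eventually (fine; and §12: the trajectory IS in `κ < 1/6`) — on tori of ODD side `2S+1` with
   time-PERIODIC Wilson fermions (the tree's `wilsonDirac`): the finite-volume functional is the
   `(−1)^F`-twisted trace, and `S → ∞` is a JOINT space-time thermodynamic limit (hypercubic tori) taken
   before `k → ∞`, while `IsQCDAlong` converges at the scheme's own side `2L_k+1` only.

RECOMMENDATION (for planners; this seat reshapes nothing): a line that wants `GapTransfer` at difficulty M
should state its lattice hypothesis in the uniform form `∃ k₀, ∀ k ≥ k₀, ∀ (A,B), ∃ C, …` (any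
Yang–Mills-side proof of a lattice gap delivers it equally) or restrict the delivered conclusion to
two-point clustering; as typed, 8923 silently contains the step "per-observable eventual bounds ⇒
full-spectrum gap of the step-`k` transfer matrix". -/

-- Targets
-- (none: no line picked yet; `stuck_stubs = []` at the arm times of cycles 1–3)

end Summit.QuantumFields.QCD.Cruxes.RobustYangMillsHandover.Disproof
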